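import Literature.MathematicalPhysics.QuantumManyBody.GroundStateFeynmanKacCutLine
import Literature.MathematicalPhysics.QuantumManyBody.BoseGasHardSet
import Literature.Probability.Process.BrownianMotion
import HarnessLib

/-!
# Crux `TwoReplicaTransienceBound` (stmt-AtomisticToContinuum-9687), line `tagged-shift-log-harnack`:
# the toolbox stub `stub_localCrowdingHardCore` (local crowding for HARD CORES, pointwise packing form)

Support file (`--supports stmt-AtomisticToContinuum-9687`, lead a1; does not close the item). The
lever of the line prices its dose terms by exponential moments of the number of BATH world-lines
(`j ≠ 0`) within range `R` of a point displaced by `z` from the TAGGED world-line (`j = 0`) at a time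
`t ∈ (0, T]`. For a HARD-CORE pair potential (`v = ⊤` on `[0, R₀]`, `R₀ > 0`) this count is bounded
DETERMINISTICALLY on the support of the Feynman–Kac weight `fkWeight v L T X₀ ω`
(`= 𝟙{survives} · e^{-pathAction}`, `GroundStateFeynmanKac.lean`):

* `LocalCrowdingHardCore.pathAction_eq_top_of_dist_lt`, `…fkWeight_eq_zero_of_dist_lt` — if two
  world-lines are at distance `< R₀` at a time `t ∈ (0, T]` then, every path being continuous in
  time (`continuous_worldLine_toNNReal`, from `continuous_brownian`), they stay so on a time interval
  `(s₁, t) ⊆ (0, T]` of positive length, on which the interaction is `⊤` (one pair term is `⊤`,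
  `BoseGas.apply_dist_le_interaction` of `BoseGasHardSet.lean`); hence the action
  `∫_{(0,T]} ∑_{i<j} v(|Bⁱ_s - Bʲ_s|) ds` is `⊤` and the weight `e^{-⊤} = 0` vanishes (the
  backward-in-time twin of `CutLineWitness.pathAction_eq_top_of_dist_lt` of
  `…WitnessTransferCoreEntry.lean`, which needs `s₀ < T`; here `t = T` is allowed and `t > 0` is used);
* `LocalCrowdingHardCore.card_le_of_separated` — **packing in `ℝ³`**: finitely many points that are
  pairwise `≥ R₀` apart and all within distance `< R` of a point `p` number at most
  `(2R/R₀ + 1)³`: the open balls of radius `R₀/2` about them are pairwise disjoint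
  (`Metric.ball_disjoint_ball`) and contained in `ball p (R + R₀/2)` (`Metric.ball_subset_ball'`),
  so by additivity and monotonicity of Lebesgue measure (`measure_biUnion_finset`, `measure_mono`)
  and the scaling of Euclidean balls (`Measure.addHaar_ball_of_pos`: `|B(y,r)| = r³ |B(0,1)|`,
  `0 < |B(0,1)| < ∞`) `card · (R₀/2)³ ≤ (R + R₀/2)³`;
* `stub_localCrowdingHardCore` — the registered statement: either some pair `i ≠ j` is at distance
  `< R₀` at time `t` (weight `0`, the inequality is `0 ≤ _`), or all pairs are `≥ R₀` apart, the bath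
  points within `R` of `p = B⁰_t + z` are `R₀`-separated, the count is `≤ (2R/R₀+1)³`, and
  `w · e^{Λ · card} ≤ e^{Λ (2R/R₀+1)³} · w` by monotonicity of `exp` (`Λ ≥ 0`).

No named facts are used; everything is [folklore].
-/

noncomputable section

open MeasureTheory Filter Set Metric
open scoped ENNReal NNReal Topology

namespace Summit.AtomisticToContinuum.BoseEinsteinCondensation.Cruxes.TwoReplicaTransienceBound.TaggedShiftLogHarnack

open Literature.MathematicalPhysics.QuantumManyBody.BoseGas

namespace LocalCrowdingHardCore

/-! ### Entering the hard core at a time `t ∈ (0, T]` kills the Feynman–Kac weight -/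

/-- **Inside the hard core the action is infinite** (backward-in-time form). If `v = ⊤` on
`[0, R₀]` and two world-lines `i ≠ j` are at distance `< R₀` at a time `t` with `0 < t ≤ T`, then
by continuity of the paths they are at distance `< R₀` on a nontrivial interval `(s₁, t) ⊆ (0, T]`,
where the interaction is `⊤`; hence `∫_{(0,T]} ∑_{i<j} v(|Bⁱ_s - Bʲ_s|) ds = ⊤`. [folklore] -/
theorem pathAction_eq_top_of_dist_lt {N : ℕ} {v : ℝ → ℝ≥0∞} {R₀ : ℝ}
    (hcore : ∀ r : ℝ, 0 ≤ r → r ≤ R₀ → v r = ⊤) {T t : ℝ} (X : Config N) (ω : PathSpace N)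
    {i j : Fin N} (hij : i ≠ j) (ht : 0 < t) (htT : t ≤ T)
    (hlt : dist (worldLine X ω t.toNNReal i) (worldLine X ω t.toNNReal j) < R₀) :
    pathAction v T X ω = ⊤ := by
  have hcont : Continuous fun s : ℝ =>
      dist (worldLine X ω s.toNNReal i) (worldLine X ω s.toNNReal j) :=
    ((continuous_apply i).comp (continuous_worldLine_toNNReal X ω)).dist
      ((continuous_apply j).comp (continuous_worldLine_toNNReal X ω))
  have hopen : IsOpen {s : ℝ |
      dist (worldLine X ω s.toNNReal i) (worldLine X ω s.toNNReal j) < R₀} :=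
    isOpen_lt hcont continuous_const
  obtain ⟨δ, hδ, hball⟩ := Metric.isOpen_iff.1 hopen t hlt
  set s₁ : ℝ := max (t - δ) 0 with hs₁
  have hs₁t : s₁ < t := max_lt (by linarith) ht
  have htop : ∀ s ∈ Ioo s₁ t, interaction v (worldLine X ω s.toNNReal) = ⊤ := by
    intro s hs
    have hsball : s ∈ Metric.ball t δ := by
      rw [Metric.mem_ball, Real.dist_eq, abs_lt]
      constructor <;> linarith [hs.1, hs.2, le_max_left (t - δ) 0]
    have hsa : dist (worldLine X ω s.toNNReal i) (worldLine X ω s.toNNReal j) < R₀ := hball hsball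
    refine eq_top_iff.2 ?_
    calc (⊤ : ℝ≥0∞) = v (dist (worldLine X ω s.toNNReal i) (worldLine X ω s.toNNReal j)) :=
          (hcore _ dist_nonneg hsa.le).symm
      _ ≤ interaction v (worldLine X ω s.toNNReal) := apply_dist_le_interaction v _ hij
  unfold pathAction
  refine eq_top_iff.2 ?_
  calc (⊤ : ℝ≥0∞) = ∫⁻ _ in Ioo s₁ t, (⊤ : ℝ≥0∞) := by
        rw [setLIntegral_const, Real.volume_Ioo, ENNReal.top_mul]
        exact (ENNReal.ofReal_pos.2 (by linarith)).ne'
    _ = ∫⁻ s in Ioo s₁ t, interaction v (worldLine X ω s.toNNReal) :=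
        setLIntegral_congr_fun measurableSet_Ioo fun s hs => (htop s hs).symm
    _ ≤ ∫⁻ s in Ioc 0 T, interaction v (worldLine X ω s.toNNReal) :=
        lintegral_mono_set fun s hs => ⟨(le_max_right (t - δ) 0).trans_lt hs.1, hs.2.le.trans htT⟩

/-- **Entering the hard core kills the Feynman–Kac weight**: under the hypotheses of
`pathAction_eq_top_of_dist_lt`, `fkWeight v L T X ω = 0` (`e^{-∞} = 0` on the survival event, and
`0` off it). [folklore] -/
theorem fkWeight_eq_zero_of_dist_lt {N : ℕ} {v : ℝ → ℝ≥0∞} {R₀ : ℝ}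
    (hcore : ∀ r : ℝ, 0 ≤ r → r ≤ R₀ → v r = ⊤) (L : ℝ) {T t : ℝ} (X : Config N)
    (ω : PathSpace N) {i j : Fin N} (hij : i ≠ j) (ht : 0 < t) (htT : t ≤ T)
    (hlt : dist (worldLine X ω t.toNNReal i) (worldLine X ω t.toNNReal j) < R₀) :
    fkWeight v L T X ω = 0 := by
  have hpa := pathAction_eq_top_of_dist_lt hcore X ω hij ht htT hlt
  unfold fkWeight
  by_cases hω : ω ∈ survives L T X
  · rw [indicator_of_mem hω, hpa, expNeg_top]
  · rw [indicator_of_notMem hω]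

/-! ### Packing in `ℝ³` -/

/-- **Packing bound in `ℝ³`.** If finitely many points `x i`, `i ∈ s`, are pairwise at distance
`≥ R₀ > 0` and all lie within distance `< R` of a point `p`, then `card s ≤ (2R/R₀ + 1)³`: the open
balls `B(x i, R₀/2)` are pairwise disjoint and contained in `B(p, R + R₀/2)`, so comparing Lebesgue
measures, `card s · (R₀/2)³ · |B(0,1)| ≤ (R + R₀/2)³ · |B(0,1)|` with `0 < |B(0,1)| < ∞`.
[folklore] -/
theorem card_le_of_separated {ι : Type*} (s : Finset ι) (x : ι → Space) (p : Space) {R R₀ : ℝ}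
    (hR : 0 < R) (hR₀ : 0 < R₀)
    (hsep : ∀ i ∈ s, ∀ j ∈ s, i ≠ j → R₀ ≤ dist (x i) (x j))
    (hin : ∀ i ∈ s, dist (x i) p < R) :
    (s.card : ℝ) ≤ (2 * R / R₀ + 1) ^ 3 := by
  -- disjoint balls of radius `R₀/2` inside the ball of radius `R + R₀/2` about `p`
  have hdisj : (s : Set ι).PairwiseDisjoint fun i => ball (x i) (R₀ / 2) := by
    intro i hi j hj hij
    exact ball_disjoint_ball (by linarith [hsep i hi j hj hij])
  have hsub : (⋃ i ∈ s, ball (x i) (R₀ / 2)) ⊆ ball p (R + R₀ / 2) := by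
    refine Set.iUnion₂_subset fun i hi => ?_
    exact ball_subset_ball' (by linarith [hin i hi])
  -- volumes of Euclidean balls scale with the cube of the radius
  have hvol : ∀ (y : Space) (r : ℝ), 0 < r →
      volume (ball y r) = ENNReal.ofReal (r ^ 3) * volume (ball (0 : Space) 1) := by
    intro y r hr
    rw [Measure.addHaar_ball_of_pos volume y hr, finrank_euclideanSpace_fin]
  have hmeas : volume (⋃ i ∈ s, ball (x i) (R₀ / 2)) = ∑ i ∈ s, volume (ball (x i) (R₀ / 2)) :=
    measure_biUnion_finset hdisj fun i _ => measurableSet_ball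
  have hle : (s.card : ℝ≥0∞) * ENNReal.ofReal ((R₀ / 2) ^ 3) * volume (ball (0 : Space) 1) ≤
      ENNReal.ofReal ((R + R₀ / 2) ^ 3) * volume (ball (0 : Space) 1) := by
    calc (s.card : ℝ≥0∞) * ENNReal.ofReal ((R₀ / 2) ^ 3) * volume (ball (0 : Space) 1)
        = ∑ i ∈ s, volume (ball (x i) (R₀ / 2)) := by
          rw [Finset.sum_congr rfl fun i _ => hvol (x i) (R₀ / 2) (by positivity),
            Finset.sum_const, nsmul_eq_mul, mul_assoc]
      _ = volume (⋃ i ∈ s, ball (x i) (R₀ / 2)) := hmeas.symm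
      _ ≤ volume (ball p (R + R₀ / 2)) := measure_mono hsub
      _ = ENNReal.ofReal ((R + R₀ / 2) ^ 3) * volume (ball (0 : Space) 1) :=
          hvol p _ (by positivity)
  have hc0 : volume (ball (0 : Space) 1) ≠ 0 := (measure_ball_pos volume _ one_pos).ne'
  have hctop : volume (ball (0 : Space) 1) ≠ ⊤ := measure_ball_lt_top.ne
  have hle' : (s.card : ℝ≥0∞) * ENNReal.ofReal ((R₀ / 2) ^ 3) ≤
      ENNReal.ofReal ((R + R₀ / 2) ^ 3) :=
    (ENNReal.mul_le_mul_iff_left hc0 hctop).1 hle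
  have hreal : (s.card : ℝ) * (R₀ / 2) ^ 3 ≤ (R + R₀ / 2) ^ 3 := by
    rw [← ENNReal.ofReal_natCast, ← ENNReal.ofReal_mul (Nat.cast_nonneg _)] at hle'
    exact (ENNReal.ofReal_le_ofReal_iff (by positivity)).1 hle'
  have hpos : 0 < (R₀ / 2) ^ 3 := by positivity
  have hR₀' : R₀ ≠ 0 := hR₀.ne'
  rw [← le_div_iff₀ hpos] at hreal
  calc (s.card : ℝ) ≤ (R + R₀ / 2) ^ 3 / (R₀ / 2) ^ 3 := hreal
    _ = (2 * R / R₀ + 1) ^ 3 := by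
        rw [← div_pow]
        congr 1
        field_simp

end LocalCrowdingHardCore

/-- **Registered toolbox stub `stub_localCrowdingHardCore`** (crux stmt-AtomisticToContinuum-9687,
line `tagged-shift-log-harnack`): **local crowding for hard cores, pointwise packing form.** For a
pair potential with a hard core of radius `R₀ > 0` (`v = ⊤` on `[0, R₀]`), any `R > 0`, `Λ ≥ 0`,
`n`, box side `L`, polymer length `T`, time `t ∈ (0, T]`, displacement `z ∈ ℝ³`, start `X₀` and
sample `ω`: with `card` the number of bath lines `j ≠ 0` within distance `< R` of `B⁰_t + z` at time
`t`, `fkWeight · e^{Λ · card} ≤ e^{Λ (2R/R₀ + 1)³} · fkWeight`. Proof: if some pair of world-lines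
is at distance `< R₀` at time `t` the weight is `0`
(`LocalCrowdingHardCore.fkWeight_eq_zero_of_dist_lt`, path continuity + `v = ⊤` on a time set of
positive measure); otherwise the counted bath points are pairwise `≥ R₀` apart inside `B(B⁰_t + z, R)`,
so `card ≤ (2R/R₀ + 1)³` (`LocalCrowdingHardCore.card_le_of_separated`), and `exp` is monotone.
[folklore] -/
theorem stub_localCrowdingHardCore :
    ∀ (v : ℝ → ℝ≥0∞) (R₀ : ℝ), 0 < R₀ → (∀ r, 0 ≤ r → r ≤ R₀ → v r = ⊤) →
    ∀ (R Λ : ℝ) (n : ℕ) (L T t : ℝ), 0 < R → 0 ≤ Λ → 0 < t → t ≤ T →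
      ∀ (z : Space) (X₀ : Config (n + 1)) (ω : PathSpace (n + 1)),
        fkWeight v L T X₀ ω *
            ENNReal.ofReal (Real.exp (Λ * ((Finset.univ.filter fun j : Fin (n + 1) =>
              j ≠ 0 ∧ dist (worldLine X₀ ω t.toNNReal j) (worldLine X₀ ω t.toNNReal 0 + z) < R).card : ℝ))) ≤
          ENNReal.ofReal (Real.exp (Λ * (2 * R / R₀ + 1) ^ 3)) * fkWeight v L T X₀ ω := by
  intro v R₀ hR₀ hcore R Λ n L T t hR hΛ ht htT z X₀ ω
  by_cases hsep : ∀ i j : Fin (n + 1), i ≠ j →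
      R₀ ≤ dist (worldLine X₀ ω t.toNNReal i) (worldLine X₀ ω t.toNNReal j)
  · -- all pairs are `≥ R₀` apart at time `t`: packing
    have hcard : ((Finset.univ.filter fun j : Fin (n + 1) =>
        j ≠ 0 ∧ dist (worldLine X₀ ω t.toNNReal j) (worldLine X₀ ω t.toNNReal 0 + z) < R).card : ℝ) ≤
        (2 * R / R₀ + 1) ^ 3 :=
      LocalCrowdingHardCore.card_le_of_separated _ (worldLine X₀ ω t.toNNReal)
        (worldLine X₀ ω t.toNNReal 0 + z) hR hR₀ (fun i _ j _ hij => hsep i j hij)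
        (fun i hi => (Finset.mem_filter.1 hi).2.2)
    rw [mul_comm]
    refine mul_le_mul' (ENNReal.ofReal_le_ofReal (Real.exp_le_exp.2 ?_)) le_rfl
    exact mul_le_mul_of_nonneg_left hcard hΛ
  · -- some pair is inside the hard core at time `t`: the weight vanishes
    push Not at hsep
    obtain ⟨i, j, hij, hlt⟩ := hsep
    rw [LocalCrowdingHardCore.fkWeight_eq_zero_of_dist_lt hcore L X₀ ω hij ht htT hlt, zero_mul]
    exact zero_le

end Summit.AtomisticToContinuum.BoseEinsteinCondensation.Cruxes.TwoReplicaTransienceBound.TaggedShiftLogHarnack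

end
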